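import Literature.AlgebraicGeometry.Frobenioids.NumberFieldLocalizations
import HarnessLib

/-!
# Frobenioids II, Proposition 1.5 (iv): automorphisms of the forgetful functors; slimness

Mochizuki, *The geometry of Frobenioids II: poly-Frobenioids*, Kyushu J. Math. **62** (2008)
401–460, §1, Proposition 1.5 (iv), author's text p. 14 [cite: MochizukiFrdII2008, Prop. 1.5 (iv) p.14].
Sequel to `NumberFieldLocalizations.lean`, same conventions: `E = P ×_{P₀} E₀` for an abstract
functor `π : E₀ ⥤ P₀` carrying the properties of Example 1.4 (ii) that each proof uses (faithful,
essentially surjective, the reconstruction bijection of (i)); the printed Proposition is the case of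
Example 1.4.

**Printed text.** "(iv) If `E ∈ Ob(E)` projects to `P ∈ Ob(P)`, then we have natural bijections
`Aut(P_P → P) ⥲ Aut(E_E → P)`; `Aut(E_E → E) ⥲ Aut(E_E → P)` [induced by composition with the natural
functors `E → P`, `E_E → P_P`]. In particular, `P` is slim if and only if `E` is; `P` is Frobenius-slim
if and only if `E` is."

**Contents.** Both maps DEFINED (`autPostToP`, `autWhiskerToP`).  PROVED: the FIRST bijection
(`autPostToP_bijective`: injectivity and surjectivity via the reconstruction bijection of (i) — the
inverse transports a natural family along "presentations" `(W, w, u)` of arrows `B → P`, and its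
independence of the presentation is the common-refinement clause); injectivity of the SECOND map
(`autWhiskerToP_injective`, from faithfulness); and the direction of the slimness clause that
[FrdII] Ex. 1.4 (iii) and §4–§5 consume, "`P` slim ⇒ `E` slim" (`isSlim_of_isSlim_fst`).
**Erratum candidate E2 (recorded neutrally, RULING P1; not typed as named facts):** the SURJECTIVITY
of the second map, hence "`E` slim ⇒ `P` slim", appears to fail already for the `E₀ → P₀` of Example
1.4 with `(Gal(F̃/F), D_v) ≅ (S₃, A₃)` (`F̃ = ℚ(∛2, ζ₃)/ℚ`, `v = 7`) and `P = P₀`: the constant family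
"translate by a generator of `A₃`" is a natural automorphism of `E_E → P` that does not lift to `E`
(an `E₀`-object `(P, Q, ι)` with `Q ↔ ℚ(∛2)` has trivial automorphism group); the printed proof rests
on the `Aut`-bijection of Example 1.4 (ii), which fails at the same instance.  The Frobenius-slim
clause ([FrdI] Def. 3.1 (i), seat abc-iut-L1-t3's `IsFrobeniusSlim`) is not typed here (TODO-merge);
its consumed direction follows from `autWhiskerToP_injective` + `autPostToP_bijective` exactly as
`isSlim_of_isSlim_fst` does.  Nothing here bears on [IUTchIII].
-/

namespace Literature.AlgebraicGeometry.Frobenioids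

open CategoryTheory

universe v₀ v₁ v₂ u₀ u₁ u₂

namespace NFLoc

section FiberProduct

variable {P₀ : Type u₀} [Category.{v₀} P₀] {E₀ : Type u₁} [Category.{v₁} E₀]
  {P : Type u₂} [Category.{v₂} P] {F : P ⥤ P₀} {π : E₀ ⥤ P₀}

/-! ### The two maps of (iv) -/

/-- `Aut(E_E → E) → Aut(E_E → P)`: composition with `E → P` (FrdII Prop. 1.5 (iv), second map,
p. 14); here `E_E → E` is `Over.forget E` and `E_E → P` is `Over.forget E ⋙ (E → P)`.
[cite: MochizukiFrdII2008, Prop. 1.5 (iv) p.14] -/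
def autWhiskerToP (X : Loc F π) : Aut (Over.forget X) →* Aut (Over.forget X ⋙ toP F π) :=
  MonoidHom.mk' (fun α => Functor.isoWhiskerRight α (toP F π)) fun α β => by
    simp only [Aut.Aut_mul_def, Functor.isoWhiskerRight_trans]

/-- `Aut(P_P → P) → Aut(E_E → P)`: composition with `E_E → P_P` (FrdII Prop. 1.5 (iv), first map,
p. 14); `E_E → P_P` is `Over.post (E → P)` and `Over.post (E → P) ⋙ (P_P → P) = (E_E → E) ⋙ (E → P)`
definitionally (`Over.post_forget_eq_forget_comp`). [cite: MochizukiFrdII2008, Prop. 1.5 (iv) p.14] -/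
def autPostToP (X : Loc F π) : Aut (Over.forget X.fst) →* Aut (Over.forget X ⋙ toP F π) :=
  MonoidHom.mk' (fun α => (Functor.isoWhiskerLeft (Over.post (toP F π)) α :)) fun _ _ => rfl

/-- Components of `autPostToP`: at `(Y, y : Y → E)` the family `α` is evaluated at `(Y_P, y_P)`.
[cite: MochizukiFrdII2008, Prop. 1.5 (iv) p.14] -/
theorem autPostToP_app (X : Loc F π) (α : Aut (Over.forget X.fst)) (U : Over X) :
    (autPostToP X α).hom.app U = α.hom.app (Over.mk U.hom.fst) := rfl

/-- Components of `autWhiskerToP`: the `P`-component of the `E`-automorphism.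
[cite: MochizukiFrdII2008, Prop. 1.5 (iv) p.14] -/
theorem autWhiskerToP_app (X : Loc F π) (β : Aut (Over.forget X)) (U : Over X) :
    (autWhiskerToP X β).hom.app U = (β.hom.app U).fst := rfl

/-- Injectivity of `Aut(E_E → E) → Aut(E_E → P)`: a family of automorphisms of objects of `E` is
determined by its `P`-components (faithfulness, (i)). [cite: MochizukiFrdII2008, Prop. 1.5 (iv) p.14] -/
theorem autWhiskerToP_injective [π.Faithful] (X : Loc F π) :
    Function.Injective (autWhiskerToP X) := by
  intro α β hαβ
  refine Iso.ext (NatTrans.ext (funext fun x => hom_eq_of_fst_eq ?_))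
  have := congrArg (fun γ : Aut (Over.forget X ⋙ toP F π) => γ.hom.app x) hαβ
  dsimp [autWhiskerToP] at this
  exact this

/-! ### Presentations of arrows `B → P` and the inverse of the first map -/

/-- A *presentation* of an arrow `f : B → E_P` of `P` (`E_P` the projection of `E ∈ Ob(E)`): an object
`W` of `E`, an isomorphism `w : W_P ⥲ B` and an arrow `u : W → E` of `E` with `u_P = w ≫ f` — the data
produced by the reconstruction bijection of Prop. 1.5 (i). [cite: MochizukiFrdII2008, Prop. 1.5 (iv) p.14] -/
structure Pres (X : Loc F π) {B : P} (f : B ⟶ X.fst) where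
  /-- the object of `E` -/
  W : Loc F π
  /-- the isomorphism `W_P ⥲ B` -/
  w : W.fst ≅ B
  /-- the arrow `W → E` lifting `w ≫ f` -/
  u : W ⟶ X
  /-- compatibility -/
  fac : u.fst = w.hom ≫ f

/-- Presentations exist (Prop. 1.5 (i)). [cite: MochizukiFrdII2008, Prop. 1.5 (iv) p.14] -/
theorem nonempty_pres [π.EssSurj] (h : HomReconstruction π) (X : Loc F π) {B : P} (f : B ⟶ X.fst) :
    Nonempty (Pres X f) := by
  obtain ⟨W, w, u, -, hw, hu, -⟩ := exists_lift₂ h X X f f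
  haveI := hw
  exact ⟨⟨W, asIso w, u, hu⟩⟩

/-- A chosen presentation. [cite: MochizukiFrdII2008, Prop. 1.5 (iv) p.14] -/
noncomputable def presOf [π.EssSurj] (h : HomReconstruction π) (X : Loc F π) {B : P}
    (f : B ⟶ X.fst) : Pres X f :=
  Classical.choice (nonempty_pres h X f)

/-- The tautological presentation of `y_P` for an arrow `y : Y → E` of `E`. [cite: MochizukiFrdII2008, Prop. 1.5 (iv) p.14] -/
def Pres.taut {X Y : Loc F π} (y : Y ⟶ X) : Pres X y.fst :=
  ⟨Y, Iso.refl _, y, (Category.id_comp _).symm⟩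

/-- The component of `c ∈ Aut(E_E → P)` at the object `(W, u : W → E)` of `E_E`, typed as an arrow
`W_P → W_P` of `P`. [cite: MochizukiFrdII2008, Prop. 1.5 (iv) p.14] -/
abbrev cAt {X : Loc F π} (c : Aut (Over.forget X ⋙ toP F π)) {W : Loc F π} (u : W ⟶ X) :
    W.fst ⟶ W.fst :=
  c.hom.app (Over.mk u)

/-- `cAt` is invertible. [cite: MochizukiFrdII2008, Prop. 1.5 (iv) p.14] -/
instance isIso_cAt {X : Loc F π} (c : Aut (Over.forget X ⋙ toP F π)) {W : Loc F π} (u : W ⟶ X) :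
    IsIso (cAt c u) :=
  inferInstanceAs (IsIso ((c.app (Over.mk u)).hom))

/-- Naturality of `c ∈ Aut(E_E → P)` along an arrow `t : (V, v) → (W, u)` of `E_E`, in `P`.
[cite: MochizukiFrdII2008, Prop. 1.5 (iv) p.14] -/
theorem cAt_naturality {X : Loc F π} (c : Aut (Over.forget X ⋙ toP F π)) {V W : Loc F π}
    {v : V ⟶ X} {u : W ⟶ X} (t : V ⟶ W) (ht : t ≫ u = v) :
    t.fst ≫ cAt c u = cAt c v ≫ t.fst :=
  c.hom.naturality (Over.homMk t ht : Over.mk v ⟶ Over.mk u)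

/-- Transport of the component of `c` along a presentation: `w⁻¹ ≫ c_{(W,u)} ≫ w : B → B`.
[cite: MochizukiFrdII2008, Prop. 1.5 (iv) p.14] -/
def Pres.comp {X : Loc F π} {B : P} {f : B ⟶ X.fst} (p : Pres X f)
    (c : Aut (Over.forget X ⋙ toP F π)) : B ⟶ B :=
  p.w.inv ≫ cAt c p.u ≫ p.w.hom

/-- The transported component as an isomorphism `B ≅ B`. [cite: MochizukiFrdII2008, Prop. 1.5 (iv) p.14] -/
noncomputable def Pres.compIso {X : Loc F π} {B : P} {f : B ⟶ X.fst} (p : Pres X f)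
    (c : Aut (Over.forget X ⋙ toP F π)) : B ≅ B :=
  p.w.symm ≪≫ asIso (cAt c p.u) ≪≫ p.w

/-- `compIso` has `comp` as its underlying arrow. [cite: MochizukiFrdII2008, Prop. 1.5 (iv) p.14] -/
@[simp] theorem Pres.compIso_hom {X : Loc F π} {B : P} {f : B ⟶ X.fst} (p : Pres X f)
    (c : Aut (Over.forget X ⋙ toP F π)) : (p.compIso c).hom = p.comp c := rfl

/-- Independence of the presentation ("the routine verification" behind (iv); uses the common-refinement
form of the reconstruction bijection and faithfulness). [cite: MochizukiFrdII2008, Prop. 1.5 (iv) p.14] -/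
theorem Pres.comp_eq [π.Faithful] [π.EssSurj] (h : HomReconstruction π) {X : Loc F π} {B : P}
    {f : B ⟶ X.fst} (p p' : Pres X f) (c : Aut (Over.forget X ⋙ toP F π)) :
    p.comp c = p'.comp c := by
  obtain ⟨V, t, t', ht, htt⟩ :=
    (homReconstruction_toP (F := F) h).surj p.W p'.W (p.w.hom ≫ p'.w.inv)
  have ht' : IsIso t.fst := ht
  have htt' : t.fst ≫ p.w.hom ≫ p'.w.inv = t'.fst := htt
  have hcomm : t'.fst ≫ p'.w.hom = t.fst ≫ p.w.hom := by rw [← htt']; simp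
  have key : t ≫ p.u = t' ≫ p'.u := hom_eq_of_fst_eq (by
    simp only [CFP.comp_fst, p.fac, p'.fac, ← Category.assoc, hcomm])
  have n1 := cAt_naturality c (u := p.u) t rfl
  have n2 := cAt_naturality c (u := p'.u) t' key.symm
  -- `n1 : t.fst ≫ c_{p.u} = c_V ≫ t.fst`, `n2 : t'.fst ≫ c_{p'.u} = c_V ≫ t'.fst`
  haveI : IsIso t'.fst := by rw [← htt']; infer_instance
  have e1 : cAt c p.u = inv t.fst ≫ cAt c (t ≫ p.u) ≫ t.fst := (IsIso.eq_inv_comp t.fst).mpr n1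
  have e2 : cAt c p'.u = inv t'.fst ≫ cAt c (t ≫ p.u) ≫ t'.fst := (IsIso.eq_inv_comp t'.fst).mpr n2
  have hcomm' : t.fst ≫ p.w.hom ≫ p'.w.inv ≫ inv t'.fst = 𝟙 _ := by
    rw [← Category.assoc, ← hcomm]; simp
  unfold Pres.comp
  rw [e1, e2]
  simp only [Category.assoc]
  rw [hcomm, Iso.inv_comp_eq, IsIso.inv_comp_eq]
  symm
  calc t.fst ≫ p.w.hom ≫ p'.w.inv ≫ inv t'.fst ≫ cAt c (t ≫ p.u) ≫ t.fst ≫ p.w.hom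
      = (t.fst ≫ p.w.hom ≫ p'.w.inv ≫ inv t'.fst) ≫ cAt c (t ≫ p.u) ≫ t.fst ≫ p.w.hom := by
        simp only [Category.assoc]
    _ = cAt c (t ≫ p.u) ≫ t.fst ≫ p.w.hom := by rw [hcomm', Category.id_comp]

/-- Naturality of the transported components in the arrow `f` ("natural bijections", p. 14): for
`k : B' → B` with `k ≫ f = f'`, `k ≫ (w⁻¹ c w)_f = (w⁻¹ c w)_{f'} ≫ k`.
[cite: MochizukiFrdII2008, Prop. 1.5 (iv) p.14] -/
theorem Pres.comp_natural [π.Faithful] [π.EssSurj] (h : HomReconstruction π) {X : Loc F π}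
    (c : Aut (Over.forget X ⋙ toP F π)) {B B' : P} {f : B ⟶ X.fst} {f' : B' ⟶ X.fst}
    (k : B' ⟶ B) (hk : k ≫ f = f') (p : Pres X f) (p' : Pres X f') :
    k ≫ p.comp c = p'.comp c ≫ k := by
  obtain ⟨V, t, m, ht, htm⟩ :=
    (homReconstruction_toP (F := F) h).surj p'.W p.W (p'.w.hom ≫ k ≫ p.w.inv)
  have ht' : IsIso t.fst := ht
  have htm' : t.fst ≫ p'.w.hom ≫ k ≫ p.w.inv = m.fst := htm
  have e3 : m.fst ≫ p.w.hom = t.fst ≫ p'.w.hom ≫ k := by rw [← htm']; simp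
  let q : Pres X f' := ⟨V, asIso t.fst ≪≫ p'.w, m ≫ p.u, by
    rw [CFP.comp_fst, p.fac, ← Category.assoc, e3, Iso.trans_hom, asIso_hom, Category.assoc,
      Category.assoc, hk, Category.assoc]⟩
  rw [Pres.comp_eq h p' q c]
  have nat := cAt_naturality c (u := p.u) m rfl
  unfold Pres.comp
  simp only [q, Iso.trans_inv, Iso.trans_hom, asIso_inv, asIso_hom, Category.assoc]
  rw [← e3, reassoc_of% nat.symm, ← htm']
  simp

/-- The inverse of the first map: transport a natural automorphism of `E_E → P` to one of `P_P → P`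
along chosen presentations (well defined by `Pres.comp_eq`, natural by `Pres.comp_natural`).
[cite: MochizukiFrdII2008, Prop. 1.5 (iv) p.14] -/
noncomputable def liftAut [π.Faithful] [π.EssSurj] (h : HomReconstruction π) (X : Loc F π)
    (c : Aut (Over.forget X ⋙ toP F π)) : Aut (Over.forget X.fst) :=
  NatIso.ofComponents (fun o => (presOf h X o.hom).compIso c) fun {o o'} k => by
    simpa using Pres.comp_natural h c k.left (Over.w k) (presOf h X o'.hom) (presOf h X o.hom)

/-- FrdII Prop. 1.5 (iv), first map, injectivity (PROVED). [cite: MochizukiFrdII2008, Prop. 1.5 (iv) p.14] -/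
theorem autPostToP_injective [π.Faithful] [π.EssSurj] (h : HomReconstruction π) (X : Loc F π) :
    Function.Injective (autPostToP X) := by
  intro α β hαβ
  refine Iso.ext (NatTrans.ext (funext fun o => ?_))
  obtain ⟨p⟩ := nonempty_pres h X o.hom
  let k : Over.mk p.u.fst ⟶ o := Over.homMk p.w.hom p.fac.symm
  have hα : p.w.hom ≫ α.hom.app o = α.hom.app (Over.mk p.u.fst) ≫ p.w.hom := α.hom.naturality k
  have hβ : p.w.hom ≫ β.hom.app o = β.hom.app (Over.mk p.u.fst) ≫ p.w.hom := β.hom.naturality k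
  have e : α.hom.app (Over.mk p.u.fst) = β.hom.app (Over.mk p.u.fst) :=
    congrArg (fun γ : Aut (Over.forget X ⋙ toP F π) => γ.hom.app (Over.mk p.u)) hαβ
  exact (cancel_epi p.w.hom).mp (by rw [hα, hβ, e])

/-- The first map inverts `liftAut` (surjectivity). [cite: MochizukiFrdII2008, Prop. 1.5 (iv) p.14] -/
theorem autPostToP_liftAut [π.Faithful] [π.EssSurj] (h : HomReconstruction π) (X : Loc F π)
    (c : Aut (Over.forget X ⋙ toP F π)) : autPostToP X (liftAut h X c) = c := by
  refine Iso.ext (NatTrans.ext (funext fun U => ?_))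
  rw [autPostToP_app]
  change ((presOf h X U.hom.fst).compIso c).hom = c.hom.app U
  rw [Pres.compIso_hom, Pres.comp_eq h _ (Pres.taut U.hom) c]
  unfold Pres.comp Pres.taut
  simp only [Iso.refl_inv, Iso.refl_hom, Category.id_comp, Category.comp_id]
  rfl

/-- FrdII Prop. 1.5 (iv), FIRST bijection `Aut(P_P → P) ⥲ Aut(E_E → P)` (PROVED, under the
Ex. 1.4 (ii) properties faithful / essentially surjective / reconstruction bijection of (i)).
[cite: MochizukiFrdII2008, Prop. 1.5 (iv) p.14] -/
theorem autPostToP_bijective [π.Faithful] [π.EssSurj] (h : HomReconstruction π) (X : Loc F π) :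
    Function.Bijective (autPostToP X) :=
  ⟨autPostToP_injective h X, fun c => ⟨liftAut h X c, autPostToP_liftAut h X c⟩⟩

/-- FrdII Prop. 1.5 (iv), "in particular", the consumed direction: `P` slim ⇒ `E` slim (PROVED: an
automorphism of `E_E → E` maps injectively to `Aut(E_E → P) ≅ Aut(P_P → P) = 1`).  The converse
("`E` slim ⇒ `P` slim") is part of erratum candidate E2 (module docstring) and is NOT typed.
[cite: MochizukiFrdII2008, Prop. 1.5 (iv) p.14] -/
theorem isSlim_of_isSlim_fst [π.Faithful] [π.EssSurj] (h : HomReconstruction π) (hP : IsSlim P) :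
    IsSlim (Loc F π) := by
  refine ⟨fun X β => ?_⟩
  obtain ⟨α, hα⟩ := (autPostToP_bijective h X).2 (autWhiskerToP X β)
  have hα1 : α = Iso.refl _ := hP.isRigid_forget X.fst α
  have h1 : autWhiskerToP X β = 1 := by
    rw [← hα, hα1]; exact map_one (autPostToP X)
  have h2 : autWhiskerToP X (Iso.refl _) = 1 := map_one _
  exact autWhiskerToP_injective X (h1.trans h2.symm)

end FiberProduct

end NFLoc

end Literature.AlgebraicGeometry.Frobenioids
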